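import Literature.MathematicalPhysics.QuantumFieldTheory.Balaban1983to89.T4CouplingMatching

/-!
# `Balaban1983to89.T4SpectralRenewal` — row T4-U2.R2-d of the uniqueness spine (cell `pub-balaban`, T4-DAG v8 §5, node
U2 / NE4): the COCYCLE ("spectral") shape of the fading-memory input of node U2, asked for by the cell's toy rung
`t4/T4-RUNG-U2R2.md` v1.2 §3(1) and GAPS G-t4-U2R2-2 — kernel-checked linear-algebra bookkeeping over an abstract
normed ring, an explicit perturbation price, and the kernel witness that a PER-STEP spectral-radius hypothesis is NOT a
sufficient form of it.  HYPOTHESIS SHAPES + BOOKKEEPING ONLY; nothing is asserted about Bałaban's renormalization maps.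

HONEST FRAMING (T4-DAG PAGE 1).  The cell's T4 target is rung (B)+1 — existence AND uniqueness of the ε → 0 limit of
Bałaban's unit-scale averaged expectations on a FIXED finite torus; NOT infinite volume, NOT a mass gap, NOT the Clay
problem.  Node U2 (tree `T4CouplingMatching`) needs the history moduli `Λ k i` of the β-functions with
`T4CouplingMatching.FadingMemory C θ Λ` : `0 ≤ Λ k i ≤ C θ^{k−i}`.  Tree `T4BetaMemory` derives that shape from a
forward renewal inequality with a NORM-type transfer bound `M_{k,j} ≤ C′ω^{k−j}` under `(1 + C′)ω < ρ < 1`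
(`T4BetaMemory.renewal_geometric`), and `T4BetaMemorySharp.not_fadingMemory_below` shows `(1 + C′)ω` is sharp over ALL
data with those constants.  The cell's toy ladder (`t4/T4-RUNG-U2R2.md` R4, §3(1); unit pv20-g4) then measured that on
an actual (caricature) dynamics the memory rate is the growth rate of the PRODUCTS of the linearised one-step bracket
maps `E_{k+1} = A E_k + V^{(k+1)}[g_k; E_k]`, far below `(1 + C′)ω` for every honest norm-constant `C′`, and located the
sharper hypothesis shape informally as «ρ(A + J′_k) ≤ θ < 1 along admissible histories» (GAPS G-t4-U2R2-2, addressed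
to the kernel lineages).  This module types that shape CORRECTLY and records what the informal wording gets wrong:

(§1) THE SHAPE IS A COCYCLE BOUND.  For one-step maps `T k` in a normed ring (`E →L[ℝ] E`, matrices, …) the transfer
from scale `i` to scale `i + n` is the ordered product `prodStep T i n = T (i+n−1) ⋯ T i`; the memory input is
`CocycleBound C θ T : ‖prodStep T i n‖ ≤ C θ^n` (uniform exponential stability of the linearised, NON-AUTONOMOUS transfer),
and `fadingMemory_of_cocycleBound` feeds `T4CouplingMatching.FadingMemory` from it and a domination of the moduli by the
transfer (`TransferDominated`, HYPOTHESIS SHAPE).  For an AUTONOMOUS reference `T k = T` it is the power bound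
`PowerBound C θ T : ‖T^n‖ ≤ C θ^n` (`cocycleBound_const_iff`), which follows from ONE contracting power `‖T^N‖ ≤ θ′^N`
with the explicit constant `Kc T θ′ N = Σ_{n<N} θ′^{−n}‖T^n‖` (`powerBound_of_pow_le`) — in a complex Banach algebra such
an `N` exists for every `θ′ > ρ(T)` by Gelfand's formula (Mathlib `spectrum.pow_nnnorm_pow_one_div_tendsto_nhds_spectralRadius`);
the power condition, not the spectral radius, is taken as the hypothesis because it is what a computation certifies and
what the bookkeeping consumes.  `Kc` is norm-DEPENDENT while the rate `θ′` is not: this is the kernel form of the toy's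
R4 ("the norm-constants C′(R) vary violently with the norm, the rate does not").

(§2) PERSISTENCE WITH AN EXPLICIT PRICE (the adapted gauge).  If the reference satisfies `‖T^N‖ ≤ θ′^N` and the actual
steps stay δ-close to it, `‖U k − T‖ ≤ δ` for all k, then `CocycleBound (Kc T θ′ N) (θ′ + Kc T θ′ N · δ) U`
(`cocycleBound_of_near_ref`, via the finite-depth adapted gauge `gauge T θ′ N S = Σ_{n<N} θ′^{−n}‖T^n S‖`, in which
multiplication by `T` contracts by `θ′` EXACTLY: `gauge_ref_mul`); with `PowerBound C θ T` and any `θ′ ∈ ]θ, ∞[` the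
constant is at most `Cθ′/(θ′ − θ)` uniformly in the depth (`Kc_le_of_powerBound`, `cocycleBound_of_powerBound`).  So the
rate of the perturbed cocycle is `θ′ + K δ` with `K = Cθ′/(θ′ − θ)`: the size `δ` of the NON-AUTONOMOUS part enters
linearly with the adapted constant, the reference rate `θ` enters only through the choice of `θ′ > θ` — NOT `(1 + C′)ω`
with the raw norm-constant of the whole transfer.  This is the standard adapted-norm (Lyapunov-norm) argument of
uniform exponential stability for discrete non-autonomous linear systems, written with finite sums so that every
constant is explicit. [folklore]

(§3) THE BRIDGE.  `TransferDominated D U Λ` (HYPOTHESIS SHAPE: the history modulus `Λ k i` of node U2 is read out,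
with a bounded constant `D`, from the transfer `prodStep U i (k − i)` — the chain rule through the bracket recursion)
and `CocycleBound C θ U` give `T4CouplingMatching.FadingMemory (D C) θ Λ` (`fadingMemory_of_cocycleBound`); with §2,
`fadingMemory_of_powerBound` states node U2's input with rate `θ′ + K δ` and constant `D K`, `K = Cθ′/(θ′ − θ)`, from a
power-contracting reference, δ-small non-autonomous part and transfer domination — fading (`rate < 1`) inside the
explicit window `θ′ + K δ < 1`.

(§4) THE HAZARD: PER-STEP SPECTRAL RADIUS IS NOT A HYPOTHESIS (kernel witness, `Matrix (Fin 2) (Fin 2) ℝ` with the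
`L¹–L^∞` operator norm `Matrix.linftyOpNormedRing`).  `T₀ = !![0,2;0,0]`, `T₁ = !![0,0;2,0]` are nilpotent
(`T₀_sq`, `T₁_sq`), so each has spectral radius ZERO (`spectralRadius_T₀`, `spectralRadius_T₁`; abstractly
`spectralRadius_eq_zero_of_sq_eq_zero`) and each ALONE is power-bounded at EVERY rate `θ′ > 0` (`powerBound_T₀`); yet the
alternating cocycle `alt = T₀, T₁, T₀, T₁, …` has `prodStep alt 0 (2m) = (T₁T₀)^m = diagonal (0, 4^m)` (`prodStep_alt`,
`T₁_mul_T₀`), norm `≥ 4^m` (`hazard_growth`), and admits NO `CocycleBound C θ alt` with `0 ≤ θ < 2`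
(`hazard_not_cocycleBound`).  Hence the informal wording of G-t4-U2R2-2, «ρ(A + J′_k) ≤ θ < 1 for all k», is NOT a
sufficient form of the memory input for a scale-DEPENDENT linearisation: what the toy measured (where `J′_k` varies
slowly along an asymptotically free trajectory) is the cocycle rate, and the honest hypothesis is `CocycleBound` itself —
obtained either from contraction of every step in ONE COMMON (adapted) norm (`cocycleBound_of_norm_le`) or from
closeness of all steps to ONE power-contracting reference (§2).  This correction is the cell's GAPS row G-t4-U2R2-5
(located; toy-side and kernel-side only — print is silent on any modulus of the step map, GAPS G-t4-U2-2, G-t4-U2R-1).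

(§5, v1.1) COMMON FLAG ⟹ NO HAZARD (kernel, `Matrix (Fin 2) (Fin 2) ℝ`).  The complement of §4: if every step preserves
ONE COMMON flag — lower-triangular in a fixed basis, `flagStep a b c = !![a,0;b,c]`, diagonal («dimension-preserving»)
rates `|a k|, |c k| ≤ θ`, lowering entry `|b k| ≤ B` — then `CocycleBound (1 + B/(θ′−θ)) θ′ (flagSeq a b c)` for EVERY
`θ′ > θ` (`flag_cocycleBound`, from the entrywise recursion `flag_entries`), with NO condition on how `a, b, c` vary with
the scale: arbitrary, arbitrarily fast non-autonomous variation INSIDE a common flag costs the constant, never the rate;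
the constant is sharp in order (`flag_entries_const`: lowering entry of the constant product `= n B θ^{n−1}`).  This is
the kernel form of the toy rung's R1(ii) («history insertions are degree-lowering at every step — nilpotent, no effect on
any rate») made UNIFORM over the history: the Taylor-degree filtration is a flag common to all steps and the
dimension-preserving diagonal carries the rate; in §4 the two nilpotent steps are triangular for OPPOSITE flags.  Two-term
flag = the minimal model (longer flags by induction on the length, not typed).  Bridge `fadingMemory_of_flag`.

(§6, v1.1) SUFFICIENT CONDITION 3 — SLOW VARIATION (frozen-step form, abstract normed ring).  If every step is
power-contracting at a common depth, `‖(U k)^N‖ ≤ θ′^N` with adapted constants `Kc (U k) θ′ N ≤ K`, and consecutive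
steps are close in the gauge drift `drift (U k) (U (k+1)) θ′ N = Σ_{n<N} θ′^{−n}‖U(k+1)^n − U(k)^n‖ ≤ η`, then
`CocycleBound K (θ′(1 + η)) U` (`cocycleBound_of_slowVariation`: the adapted gauge of the CURRENT step is a
time-dependent Lyapunov norm — the step contracts it by `θ′`, `gauge_ref_mul`; handing over to the next step's gauge
costs `1 + η`, `gauge_le_gauge_add_drift`); in plain-norm terms `‖U k‖ ≤ M`, `‖U(k+1) − U k‖ ≤ ε` give
`η = Ec M θ′ N · ε`, `Ec M θ′ N = Σ_{n<N} θ′^{−n} n M^{n−1}` (`drift_le`, `norm_pow_sub_pow_le`,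
`cocycleBound_of_slowVariation'`); bridge `fadingMemory_of_slowVariation`.  THIS is the clause missing from the wording
«ρ(A + J′_k) ≤ θ < 1 ∀k»: per-step contraction in the uniform, norm-visible form (`‖(U k)^N‖ ≤ θ′^N`, `Kc ≤ K`) PLUS
slow variation; for §4's `alt` the drift at depth 2 is `η = 2/θ′`, whence only `θ′ + 2 ≥ 2`, consistent with
`hazard_not_cocycleBound`.  Discrete analogue of the Coppel–Henry «slowly varying coefficients» theorems (orientation as
below); kernel-proved with finite sums, every constant explicit.  v1.1 is APPEND-ONLY: the v1 declarations are unchanged.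

WHAT PRINT SAYS.  Nothing of the above is printed: [Balaban1987RG1], [Balaban1988Convergent] state no modulus of
continuity of one renormalization step in the previous action and no comparison across lattice spacings (the verbatim
quotations bearing on node U2 — [Balaban1987RG1] p. 256 (0.20)–(0.23), p. 268 (2.12)–(2.15), p. 298; [Balaban1988Convergent]
Theorem 2 (2.43) p. 263 and p. 262 — are reproduced in the header of tree `T4BetaMemory` and are not repeated here; this
module quotes nothing further and cites the manuscripts under adjudication for NOTHING).  The linear-algebra content is
textbook material on uniform exponential stability of non-autonomous linear difference equations (ORIENTATION ONLY, not
used: the perturbed rate `θ′ + Kδ` is the discrete analogue of the rate `α + KM` of the stability-by-first-approximation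
argument, e.g. Anagnostopoulou–Pötzsche–Rasmussen, *Nonautonomous Bifurcation Theory*, Springer 2023, Appendix A (A.9),
held `book:anagnostopoulou2023-nonautonomous-bifurcation-theory`, whose §5.1 points to the discrete Roughness Theorem in
D. Henry, *Geometric Theory of Semilinear Parabolic Equations*, LNM 840 (1981), Thm 7.6.7) and on products of matrices
(growth of products of individually nilpotent matrices — the phenomenon behind the joint spectral radius); everything is
kernel-proved here, so every declaration is tagged [folklore] or is a HYPOTHESIS SHAPE.

CITATION HEADER (lean-in-tree rule 2026-08-18).  T. Bałaban, *Renormalization group approach to lattice gauge field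
theories. I*, Commun. Math. Phys. **109**, 249–301 (1987) [Balaban1987RG1] (cell paper B12 = [I]; held
`paper:balaban1987-cmp109-rg-i-small-field`); T. Bałaban, *Convergent renormalization expansions for lattice gauge
theories*, Commun. Math. Phys. **119**, 243–285 (1988) [Balaban1988Convergent] (B14 = [III]) — both referenced ONLY
through the quotations in `T4BetaMemory`'s header, for orientation.  NEW module of unit `b2b-balaban-pv20-g5` (SURGE
NODE PROVER #20 gen 5; journal claim T4-U2.R2-d SPECTRAL-RENEWAL-KERNEL 2026-08-19T01:27:33Z); imports
`T4CouplingMatching` only, re-declares nothing of `T4BetaMemory` / `T4BetaMemorySharp`; no `sorry`, no `axiom`.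
v1.1 (same unit, 2026-08-19): APPEND-ONLY §5 (common flag) and §6 (slow variation); v1 = p182186.
Value = kernel certificate of the hypothesis shape + the located correction of G-t4-U2R2-2; NOT summit progress.
-/

namespace Literature.MathematicalPhysics.QuantumFieldTheory.Balaban1983to89.T4SpectralRenewal

open Literature.MathematicalPhysics.QuantumFieldTheory.Balaban1983to89.T4CouplingMatching
open Finset

/-! ## §1 The transfer cocycle and its exponential stability (definitions, autonomous case) -/

section Cocycle

variable {A : Type*} [Monoid A]

/-- The TRANSFER COCYCLE of a sequence of one-step maps: `prodStep T i n = T (i + n − 1) * ⋯ * T (i + 1) * T i`, the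
ordered product of the `n` steps starting at scale `i` (`prodStep T i 0 = 1`).  For the linearised bracket maps of the
toy rung (`E_{k+1} = (A + J′_k) E_k`), `prodStep T i (k − i)` transports a perturbation born at scale `i` to scale `k`.
[folklore] -/
def prodStep (T : ℕ → A) (i : ℕ) : ℕ → A
  | 0 => 1
  | n + 1 => T (i + n) * prodStep T i n

/-- No step transports by the identity. [folklore] -/
@[simp] theorem prodStep_zero (T : ℕ → A) (i : ℕ) : prodStep T i 0 = 1 := rfl

/-- One more step multiplies on the LEFT by the next map. [folklore] -/
theorem prodStep_succ (T : ℕ → A) (i n : ℕ) : prodStep T i (n + 1) = T (i + n) * prodStep T i n := rfl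

/-- For a constant (AUTONOMOUS) sequence the cocycle is the power: `prodStep (fun _ => T) i n = T ^ n`. [folklore] -/
@[simp] theorem prodStep_const (T : A) (i n : ℕ) : prodStep (fun _ => T) i n = T ^ n := by
  induction n with
  | zero => simp
  | succ n ih => rw [prodStep_succ, ih, pow_succ']

/-- Cocycle (two-parameter semigroup) property: transporting `n + m` steps from `i` is transporting `n` steps from `i`,
then `m` steps from `i + n`. [folklore] -/
theorem prodStep_add (T : ℕ → A) (i n m : ℕ) :
    prodStep T i (n + m) = prodStep T (i + n) m * prodStep T i n := by
  induction m with
  | zero => simp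
  | succ m ih =>
    rw [show n + (m + 1) = (n + m) + 1 from rfl, prodStep_succ, ih, prodStep_succ, mul_assoc,
      show i + (n + m) = i + n + m from (Nat.add_assoc i n m).symm]

end Cocycle

section Normed

variable {A : Type*} [NormedRing A]

/-- HYPOTHESIS SHAPE (structural, NOT PRINTED) — UNIFORM EXPONENTIAL STABILITY OF THE TRANSFER COCYCLE:
`‖prodStep T i n‖ ≤ C θ^n` for all starting scales `i` and all lengths `n`.  This is the located sharp form of node U2's
memory input (cell GAPS G-t4-U2R2-2 / G-t4-U2R2-5): it is what `fadingMemory_of_cocycleBound` consumes, it is implied by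
contraction of every step in one common norm (`cocycleBound_of_norm_le`) and by closeness to a power-contracting
reference (`cocycleBound_of_near_ref`), and it is NOT implied by a bound on the spectral radius of each step
(`hazard_not_cocycleBound`). [folklore] -/
def CocycleBound (C θ : ℝ) (T : ℕ → A) : Prop :=
  ∀ i n, ‖prodStep T i n‖ ≤ C * θ ^ n

/-- HYPOTHESIS SHAPE — POWER BOUND of a single (reference) map: `‖T ^ n‖ ≤ C θ^n` for all `n`; the autonomous case of
`CocycleBound` (`cocycleBound_const_iff`).  In a complex Banach algebra it holds for every `θ > ρ(T)` with some `C`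
(Gelfand's formula, Mathlib `spectrum.pow_nnnorm_pow_one_div_tendsto_nhds_spectralRadius`), and `powerBound_of_pow_le`
derives it, with an explicit constant, from ONE contracting power. [folklore] -/
def PowerBound (C θ : ℝ) (T : A) : Prop :=
  ∀ n, ‖T ^ n‖ ≤ C * θ ^ n

/-- Autonomous case: the cocycle bound of a constant sequence is the power bound. [folklore] -/
theorem cocycleBound_const_iff {C θ : ℝ} {T : A} : CocycleBound C θ (fun _ => T) ↔ PowerBound C θ T := by
  constructor
  · intro h n
    simpa using h 0 n
  · intro h i n
    simpa using h n

/-- Monotonicity in the constants (rates can always be worsened). [folklore] -/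
theorem CocycleBound.mono {C C' θ θ₂ : ℝ} {T : ℕ → A} (h : CocycleBound C θ T) (hC : C ≤ C') (hθ0 : 0 ≤ θ)
    (hθ : θ ≤ θ₂) (hC' : 0 ≤ C') : CocycleBound C' θ₂ T := fun i n =>
  (h i n).trans (mul_le_mul hC (pow_le_pow_left₀ hθ0 hθ n) (pow_nonneg hθ0 _) hC')

/-- SUFFICIENT CONDITION 1 — contraction of EVERY step in ONE COMMON norm: `‖T k‖ ≤ θ` for all `k` gives
`CocycleBound ‖1‖ θ T` (sub-multiplicativity; the constant `‖(1 : A)‖` is `1` in any norm-one class, next lemma).  The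
common norm is essential — `hazard_not_cocycleBound` has every step of spectral radius `0`. [folklore] -/
theorem cocycleBound_of_norm_le' {θ : ℝ} {T : ℕ → A} (hθ : 0 ≤ θ) (h : ∀ k, ‖T k‖ ≤ θ) :
    CocycleBound ‖(1 : A)‖ θ T := by
  intro i n
  induction n with
  | zero => simp
  | succ n ih =>
    rw [prodStep_succ, pow_succ]
    calc ‖T (i + n) * prodStep T i n‖ ≤ ‖T (i + n)‖ * ‖prodStep T i n‖ := norm_mul_le _ _
      _ ≤ θ * (‖(1 : A)‖ * θ ^ n) := mul_le_mul (h _) ih (norm_nonneg _) hθ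
      _ = ‖(1 : A)‖ * (θ ^ n * θ) := by ring

/-- SUFFICIENT CONDITION 1 in a norm-one class (e.g. `E →L[ℝ] E` with `E` nontrivial, or matrices with an operator
norm): `‖T k‖ ≤ θ` for all `k` gives `CocycleBound 1 θ T`. [folklore] -/
theorem cocycleBound_of_norm_le [NormOneClass A] {θ : ℝ} {T : ℕ → A} (hθ : 0 ≤ θ) (h : ∀ k, ‖T k‖ ≤ θ) :
    CocycleBound 1 θ T := by
  simpa using cocycleBound_of_norm_le' hθ h

/-- THE ADAPTED CONSTANT (price of the reference `T` at rate `θ′` and depth `N`):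
`Kc T θ′ N = Σ_{n<N} θ′^{−n} ‖T ^ n‖` — the gauge of the identity (`gauge_one`).  It is the constant in
`powerBound_of_pow_le` and the factor multiplying the perturbation size in `cocycleBound_of_near_ref`; it depends on the
NORM (through `‖T^n‖`, `n < N`) while the rate does not — the kernel form of the toy rung's R4. [folklore] -/
noncomputable def Kc (T : A) (θ' : ℝ) (N : ℕ) : ℝ := ∑ n ∈ range N, θ'⁻¹ ^ n * ‖T ^ n‖

/-- The adapted constant is non-negative. [folklore] -/
theorem Kc_nonneg (T : A) {θ' : ℝ} (hθ : 0 ≤ θ') (N : ℕ) : 0 ≤ Kc T θ' N :=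
  Finset.sum_nonneg fun _ _ => mul_nonneg (pow_nonneg (inv_nonneg.mpr hθ) _) (norm_nonneg _)

/-- Each term is below the adapted constant: `θ′^{−r}‖T^r‖ ≤ Kc T θ′ N` for `r < N`. [folklore] -/
theorem term_le_Kc (T : A) {θ' : ℝ} (hθ : 0 ≤ θ') {r N : ℕ} (hr : r < N) :
    θ'⁻¹ ^ r * ‖T ^ r‖ ≤ Kc T θ' N :=
  Finset.single_le_sum (f := fun n => θ'⁻¹ ^ n * ‖T ^ n‖)
    (fun _ _ => mul_nonneg (pow_nonneg (inv_nonneg.mpr hθ) _) (norm_nonneg _)) (Finset.mem_range.mpr hr)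

/-- In particular `‖1‖ ≤ Kc T θ′ N` once `N ≥ 1` (the term `r = 0`). [folklore] -/
theorem norm_one_le_Kc (T : A) {θ' : ℝ} (hθ : 0 ≤ θ') {N : ℕ} (hN : 1 ≤ N) : ‖(1 : A)‖ ≤ Kc T θ' N := by
  simpa using term_le_Kc T hθ (show 0 < N from hN)

/-- SUFFICIENT CONDITION 2 (autonomous) — ONE CONTRACTING POWER GIVES THE POWER BOUND, with the explicit constant:
`0 < θ′`, `1 ≤ N`, `‖T ^ N‖ ≤ θ′ ^ N` ⟹ `‖T ^ n‖ ≤ Kc T θ′ N · θ′^n` for all `n` (write `n = qN + r`, `r < N`).  With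
`θ′ > ρ(T)` such an `N` always exists in a complex Banach algebra (Gelfand); here the power condition is the hypothesis.
[folklore] -/
theorem powerBound_of_pow_le {T : A} {θ' : ℝ} {N : ℕ} (hθ : 0 < θ') (hN : 1 ≤ N) (h : ‖T ^ N‖ ≤ θ' ^ N) :
    PowerBound (Kc T θ' N) θ' T := by
  have hθ0 : θ' ≠ 0 := hθ.ne'
  have aux : ∀ q r : ℕ, ‖T ^ (q * N + r)‖ ≤ θ' ^ (q * N) * ‖T ^ r‖ := by
    intro q r
    induction q with
    | zero => simp
    | succ q ih =>
      rw [show (q + 1) * N + r = N + (q * N + r) by ring, pow_add T N (q * N + r),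
        show (q + 1) * N = N + q * N by ring, pow_add θ' N (q * N)]
      calc ‖T ^ N * T ^ (q * N + r)‖ ≤ ‖T ^ N‖ * ‖T ^ (q * N + r)‖ := norm_mul_le _ _
        _ ≤ θ' ^ N * (θ' ^ (q * N) * ‖T ^ r‖) := mul_le_mul h ih (norm_nonneg _) (pow_nonneg hθ.le _)
        _ = θ' ^ N * θ' ^ (q * N) * ‖T ^ r‖ := (mul_assoc _ _ _).symm
  intro n
  obtain ⟨q, r, hr, rfl⟩ : ∃ q r, r < N ∧ q * N + r = n :=
    ⟨n / N, n % N, Nat.mod_lt n hN, Nat.div_add_mod' n N⟩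
  calc ‖T ^ (q * N + r)‖ ≤ θ' ^ (q * N) * ‖T ^ r‖ := aux q r
    _ = θ' ^ (q * N + r) * (θ'⁻¹ ^ r * ‖T ^ r‖) := by
        rw [pow_add, inv_pow]
        field_simp
    _ ≤ θ' ^ (q * N + r) * Kc T θ' N :=
        mul_le_mul_of_nonneg_left (term_le_Kc T hθ.le hr) (pow_nonneg hθ.le _)
    _ = Kc T θ' N * θ' ^ (q * N + r) := mul_comm _ _

/-- Under a power bound at rate `θ` the adapted constant at any larger rate `θ′` is bounded UNIFORMLY IN THE DEPTH:
`Kc T θ′ N ≤ C θ′/(θ′ − θ)` (geometric series in `θ/θ′`).  This is the explicit price of trading the reference rate `θ`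
for `θ′`. [folklore] -/
theorem Kc_le_of_powerBound {T : A} {C θ θ' : ℝ} (hP : PowerBound C θ T) (hθ : 0 ≤ θ) (hθ' : θ < θ') (N : ℕ) :
    Kc T θ' N ≤ C * θ' / (θ' - θ) := by
  have hθ'0 : 0 < θ' := hθ.trans_lt hθ'
  have hθ'ne : θ' ≠ 0 := hθ'0.ne'
  have hC : 0 ≤ C := by
    have h0 := hP 0
    simp only [pow_zero, mul_one] at h0
    exact (norm_nonneg _).trans h0
  have hx0 : 0 ≤ θ / θ' := div_nonneg hθ hθ'0.le
  have hx1 : θ / θ' < 1 := (div_lt_one hθ'0).mpr hθ'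
  have hterm : ∀ n, θ'⁻¹ ^ n * ‖T ^ n‖ ≤ C * (θ / θ') ^ n := fun n => by
    calc θ'⁻¹ ^ n * ‖T ^ n‖ ≤ θ'⁻¹ ^ n * (C * θ ^ n) :=
          mul_le_mul_of_nonneg_left (hP n) (pow_nonneg (inv_nonneg.mpr hθ'0.le) _)
      _ = C * (θ / θ') ^ n := by rw [div_pow]; ring
  have hgeom : ∑ n ∈ range N, (θ / θ') ^ n ≤ 1 / (1 - θ / θ') := by
    rw [le_div_iff₀ (sub_pos.mpr hx1), geom_sum_mul_neg]
    linarith [pow_nonneg hx0 N]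
  have hrew : 1 / (1 - θ / θ') = θ' / (θ' - θ) := by
    have : 1 - θ / θ' = (θ' - θ) / θ' := by field_simp
    rw [this, one_div, inv_div]
  calc Kc T θ' N ≤ ∑ n ∈ range N, C * (θ / θ') ^ n := Finset.sum_le_sum fun n _ => hterm n
    _ = C * ∑ n ∈ range N, (θ / θ') ^ n := (Finset.mul_sum _ _ _).symm
    _ ≤ C * (1 / (1 - θ / θ')) := mul_le_mul_of_nonneg_left hgeom hC
    _ = C * θ' / (θ' - θ) := by rw [hrew, mul_div_assoc]

/-- Under a power bound at rate `θ`, for every larger rate `θ′` SOME power contracts at rate `θ′`: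
`∃ N ≥ 1, ‖T ^ N‖ ≤ θ′ ^ N` (Archimedean property; the depth `N` is where `C (θ/θ′)^N ≤ 1`). [folklore] -/
theorem exists_depth {T : A} {C θ θ' : ℝ} (hP : PowerBound C θ T) (hθ : 0 ≤ θ) (hθ' : θ < θ') :
    ∃ N, 1 ≤ N ∧ ‖T ^ N‖ ≤ θ' ^ N := by
  have hθ'0 : 0 < θ' := hθ.trans_lt hθ'
  have hC : 0 ≤ C := by
    have h0 := hP 0
    simp only [pow_zero, mul_one] at h0
    exact (norm_nonneg _).trans h0
  have hy0 : 0 ≤ θ / θ' := div_nonneg hθ hθ'0.le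
  have hy1 : θ / θ' < 1 := (div_lt_one hθ'0).mpr hθ'
  rcases hC.eq_or_lt with hC0 | hCpos
  · refine ⟨1, le_rfl, ?_⟩
    have h1 := hP 1
    rw [← hC0, zero_mul] at h1
    exact h1.trans (pow_nonneg hθ'0.le _)
  · obtain ⟨n, hn⟩ := exists_pow_lt_of_lt_one (one_div_pos.mpr hCpos) hy1
    refine ⟨n + 1, Nat.succ_le_succ (Nat.zero_le _), ?_⟩
    have hyn : (θ / θ') ^ (n + 1) ≤ 1 / C := (pow_le_pow_of_le_one hy0 hy1.le (Nat.le_succ n)).trans hn.le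
    have hθn : θ ^ (n + 1) = (θ / θ') ^ (n + 1) * θ' ^ (n + 1) := by
      rw [div_pow, div_mul_cancel₀]
      exact pow_ne_zero _ hθ'0.ne'
    calc ‖T ^ (n + 1)‖ ≤ C * θ ^ (n + 1) := hP (n + 1)
      _ = C * (θ / θ') ^ (n + 1) * θ' ^ (n + 1) := by rw [hθn, mul_assoc]
      _ ≤ 1 * θ' ^ (n + 1) := by
          refine mul_le_mul_of_nonneg_right ?_ (pow_nonneg hθ'0.le _)
          calc C * (θ / θ') ^ (n + 1) ≤ C * (1 / C) := mul_le_mul_of_nonneg_left hyn hC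
            _ = 1 := by field_simp
      _ = θ' ^ (n + 1) := one_mul _

/-! ## §2 Persistence under non-autonomous perturbation: the adapted gauge and the explicit price -/

/-- THE ADAPTED GAUGE of depth `N` and rate `θ′` relative to the reference `T`:
`gauge T θ′ N S = Σ_{n<N} θ′^{−n} ‖T ^ n * S‖`.  It dominates the norm (`norm_le_gauge`), is dominated by `Kc · ‖S‖`
(`gauge_le_Kc_mul`), and — the point — left multiplication by the reference contracts it by EXACTLY `θ′` as soon as
`‖T ^ N‖ ≤ θ′ ^ N` (`gauge_ref_mul`).  Finite sums only: every constant below is explicit. [folklore] -/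
noncomputable def gauge (T : A) (θ' : ℝ) (N : ℕ) (S : A) : ℝ := ∑ n ∈ range N, θ'⁻¹ ^ n * ‖T ^ n * S‖

/-- The gauge of the identity is the adapted constant. [folklore] -/
theorem gauge_one (T : A) (θ' : ℝ) (N : ℕ) : gauge T θ' N 1 = Kc T θ' N := by
  simp [gauge, Kc]

/-- The gauge is non-negative. [folklore] -/
theorem gauge_nonneg (T : A) {θ' : ℝ} (hθ : 0 ≤ θ') (N : ℕ) (S : A) : 0 ≤ gauge T θ' N S :=
  Finset.sum_nonneg fun _ _ => mul_nonneg (pow_nonneg (inv_nonneg.mpr hθ) _) (norm_nonneg _)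

/-- The gauge dominates the norm (its `n = 0` term), for depth `N ≥ 1`. [folklore] -/
theorem norm_le_gauge (T : A) {θ' : ℝ} (hθ : 0 ≤ θ') {N : ℕ} (hN : 1 ≤ N) (S : A) : ‖S‖ ≤ gauge T θ' N S := by
  have h := Finset.single_le_sum (f := fun n => θ'⁻¹ ^ n * ‖T ^ n * S‖)
    (fun _ _ => mul_nonneg (pow_nonneg (inv_nonneg.mpr hθ) _) (norm_nonneg _))
    (Finset.mem_range.mpr (show 0 < N from hN))
  simpa [gauge] using h

/-- The gauge is dominated by the adapted constant times the norm. [folklore] -/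
theorem gauge_le_Kc_mul (T : A) {θ' : ℝ} (hθ : 0 ≤ θ') (N : ℕ) (S : A) :
    gauge T θ' N S ≤ Kc T θ' N * ‖S‖ := by
  unfold gauge Kc
  rw [Finset.sum_mul]
  refine Finset.sum_le_sum fun n _ => ?_
  rw [mul_assoc]
  exact mul_le_mul_of_nonneg_left (norm_mul_le _ _) (pow_nonneg (inv_nonneg.mpr hθ) _)

/-- The gauge is subadditive. [folklore] -/
theorem gauge_add_le (T : A) {θ' : ℝ} (hθ : 0 ≤ θ') (N : ℕ) (X Y : A) :
    gauge T θ' N (X + Y) ≤ gauge T θ' N X + gauge T θ' N Y := by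
  unfold gauge
  rw [← Finset.sum_add_distrib]
  refine Finset.sum_le_sum fun n _ => ?_
  rw [← mul_add, mul_add (T ^ n)]
  exact mul_le_mul_of_nonneg_left (norm_add_le _ _) (pow_nonneg (inv_nonneg.mpr hθ) _)

/-- THE REFERENCE CONTRACTS THE GAUGE BY EXACTLY `θ′`: `‖T ^ N‖ ≤ θ′ ^ N` (`N ≥ 1`, `θ′ > 0`) ⟹
`gauge T θ′ N (T * S) ≤ θ′ · gauge T θ′ N S` (index shift; the top term `θ′^{−N}‖T^N S‖ ≤ ‖S‖` is absorbed by the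
bottom one). [folklore] -/
theorem gauge_ref_mul {T : A} {θ' : ℝ} {N : ℕ} (hθ : 0 < θ') (hN : 1 ≤ N) (h : ‖T ^ N‖ ≤ θ' ^ N) (S : A) :
    gauge T θ' N (T * S) ≤ θ' * gauge T θ' N S := by
  obtain ⟨M, rfl⟩ : ∃ M, N = M + 1 := ⟨N - 1, (Nat.sub_add_cancel hN).symm⟩
  have hθ0 : θ' ≠ 0 := hθ.ne'
  set f : ℕ → ℝ := fun m => θ'⁻¹ ^ m * ‖T ^ m * S‖ with hf
  have step : ∀ n, θ'⁻¹ ^ n * ‖T ^ n * (T * S)‖ = θ' * f (n + 1) := by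
    intro n
    have e : T ^ n * (T * S) = T ^ (n + 1) * S := by rw [pow_succ, mul_assoc]
    rw [e, hf]
    show θ'⁻¹ ^ n * ‖T ^ (n + 1) * S‖ = θ' * (θ'⁻¹ ^ (n + 1) * ‖T ^ (n + 1) * S‖)
    rw [pow_succ θ'⁻¹ n, show θ' * (θ'⁻¹ ^ n * θ'⁻¹ * ‖T ^ (n + 1) * S‖)
        = (θ' * θ'⁻¹) * (θ'⁻¹ ^ n * ‖T ^ (n + 1) * S‖) by ring, mul_inv_cancel₀ hθ0, one_mul]
  have hlast : f (M + 1) ≤ f 0 := by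
    have e0 : f 0 = ‖S‖ := by simp [hf]
    rw [e0]
    calc f (M + 1) = θ'⁻¹ ^ (M + 1) * ‖T ^ (M + 1) * S‖ := rfl
      _ ≤ θ'⁻¹ ^ (M + 1) * (θ' ^ (M + 1) * ‖S‖) := by
          refine mul_le_mul_of_nonneg_left ?_ (pow_nonneg (inv_nonneg.mpr hθ.le) _)
          exact (norm_mul_le _ _).trans (mul_le_mul_of_nonneg_right h (norm_nonneg _))
      _ = ‖S‖ := by rw [← mul_assoc, ← mul_pow, inv_mul_cancel₀ hθ0, one_pow, one_mul]
  calc gauge T θ' (M + 1) (T * S) = ∑ n ∈ range (M + 1), θ' * f (n + 1) :=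
        Finset.sum_congr rfl fun n _ => step n
    _ = θ' * (∑ n ∈ range M, f (n + 1) + f (M + 1)) := by rw [← Finset.mul_sum, Finset.sum_range_succ]
    _ ≤ θ' * (∑ n ∈ range M, f (n + 1) + f 0) := by gcongr
    _ = θ' * gauge T θ' (M + 1) S := by rw [gauge, Finset.sum_range_succ']

/-- ONE PERTURBED STEP: if `‖T ^ N‖ ≤ θ′ ^ N` and `‖U − T‖ ≤ δ`, then
`gauge (U * S) ≤ (θ′ + Kc T θ′ N · δ) · gauge S` (`U S = T S + (U − T) S`, `gauge_ref_mul` on the first term,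
`gauge ≤ Kc‖·‖ ≤ Kc δ ‖S‖ ≤ Kc δ · gauge S` on the second). [folklore] -/
theorem gauge_step_le {T U : A} {θ' δ : ℝ} {N : ℕ} (hθ : 0 < θ') (hN : 1 ≤ N) (h : ‖T ^ N‖ ≤ θ' ^ N)
    (hU : ‖U - T‖ ≤ δ) (S : A) :
    gauge T θ' N (U * S) ≤ (θ' + Kc T θ' N * δ) * gauge T θ' N S := by
  have hK : 0 ≤ Kc T θ' N := Kc_nonneg T hθ.le N
  have hsplit : U * S = T * S + (U - T) * S := by rw [sub_mul]; abel
  have h2 : gauge T θ' N ((U - T) * S) ≤ Kc T θ' N * δ * gauge T θ' N S := by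
    calc gauge T θ' N ((U - T) * S) ≤ Kc T θ' N * ‖(U - T) * S‖ := gauge_le_Kc_mul T hθ.le N _
      _ ≤ Kc T θ' N * (δ * ‖S‖) :=
          mul_le_mul_of_nonneg_left ((norm_mul_le _ _).trans
            (mul_le_mul_of_nonneg_right hU (norm_nonneg _))) hK
      _ ≤ Kc T θ' N * (δ * gauge T θ' N S) :=
          mul_le_mul_of_nonneg_left (mul_le_mul_of_nonneg_left (norm_le_gauge T hθ.le hN S)
            ((norm_nonneg _).trans hU)) hK
      _ = Kc T θ' N * δ * gauge T θ' N S := (mul_assoc _ _ _).symm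
  calc gauge T θ' N (U * S) = gauge T θ' N (T * S + (U - T) * S) := by rw [hsplit]
    _ ≤ gauge T θ' N (T * S) + gauge T θ' N ((U - T) * S) := gauge_add_le T hθ.le N _ _
    _ ≤ θ' * gauge T θ' N S + Kc T θ' N * δ * gauge T θ' N S := add_le_add (gauge_ref_mul hθ hN h S) h2
    _ = (θ' + Kc T θ' N * δ) * gauge T θ' N S := by ring

/-- **PERSISTENCE OF THE COCYCLE BOUND NEAR A POWER-CONTRACTING REFERENCE, EXPLICIT PRICE.**  If `‖T ^ N‖ ≤ θ′ ^ N`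
(`θ′ > 0`, `N ≥ 1`) and every actual step is δ-close to the reference, `‖U k − T‖ ≤ δ`, then
`CocycleBound (Kc T θ′ N) (θ′ + Kc T θ′ N · δ) U`: the products of the NON-AUTONOMOUS steps decay at rate `θ′ + K δ`,
`K = Kc T θ′ N = Σ_{n<N} θ′^{−n}‖T^n‖`.  The size of the non-autonomous part enters the RATE linearly with the adapted
constant; nothing else does.  (Induction on the length with `gauge_step_le`, then `‖·‖ ≤ gauge ≤ … ≤ rateⁿ · gauge 1`
and `gauge 1 = Kc`.) [folklore] -/
theorem cocycleBound_of_near_ref {T : A} {U : ℕ → A} {θ' δ : ℝ} {N : ℕ} (hθ : 0 < θ') (hN : 1 ≤ N)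
    (h : ‖T ^ N‖ ≤ θ' ^ N) (hU : ∀ k, ‖U k - T‖ ≤ δ) :
    CocycleBound (Kc T θ' N) (θ' + Kc T θ' N * δ) U := by
  have hδ : 0 ≤ δ := (norm_nonneg _).trans (hU 0)
  have hK : 0 ≤ Kc T θ' N := Kc_nonneg T hθ.le N
  have hρ : 0 ≤ θ' + Kc T θ' N * δ := by positivity
  intro i n
  have key : ∀ n, gauge T θ' N (prodStep U i n) ≤ (θ' + Kc T θ' N * δ) ^ n * Kc T θ' N := by
    intro n
    induction n with
    | zero => simp [gauge_one]
    | succ n ih =>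
      rw [prodStep_succ, pow_succ]
      calc gauge T θ' N (U (i + n) * prodStep U i n)
            ≤ (θ' + Kc T θ' N * δ) * gauge T θ' N (prodStep U i n) := gauge_step_le hθ hN h (hU _) _
        _ ≤ (θ' + Kc T θ' N * δ) * ((θ' + Kc T θ' N * δ) ^ n * Kc T θ' N) :=
            mul_le_mul_of_nonneg_left ih hρ
        _ = (θ' + Kc T θ' N * δ) ^ n * (θ' + Kc T θ' N * δ) * Kc T θ' N := by ring
  calc ‖prodStep U i n‖ ≤ gauge T θ' N (prodStep U i n) := norm_le_gauge T hθ.le hN _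
    _ ≤ (θ' + Kc T θ' N * δ) ^ n * Kc T θ' N := key n
    _ = Kc T θ' N * (θ' + Kc T θ' N * δ) ^ n := mul_comm _ _

/-- **THE SAME WITH RATE-LEVEL CONSTANTS ONLY.**  `PowerBound C θ T`, `0 ≤ θ < θ′`, `‖U k − T‖ ≤ δ` for all `k` ⟹
`CocycleBound K (θ′ + K δ) U` with `K = C θ′/(θ′ − θ)` — uniformly in everything else.  Read against the toy rung's R4:
the memory rate of a slowly-varying linearisation `A + J′_k = T + (U k − T)` is `θ′ + K · sup_k ‖J′_k − J′_ref‖` for any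
`θ′` above the reference rate, NOT `(1 + C′)ω` with the norm-constant `C′` of the whole transfer. [folklore] -/
theorem cocycleBound_of_powerBound {T : A} {U : ℕ → A} {C θ θ' δ : ℝ} (hP : PowerBound C θ T) (hθ : 0 ≤ θ)
    (hθ' : θ < θ') (hU : ∀ k, ‖U k - T‖ ≤ δ) :
    CocycleBound (C * θ' / (θ' - θ)) (θ' + C * θ' / (θ' - θ) * δ) U := by
  obtain ⟨N, hN, hTN⟩ := exists_depth hP hθ hθ'
  have hθ'0 : 0 < θ' := hθ.trans_lt hθ'
  have hδ : 0 ≤ δ := (norm_nonneg _).trans (hU 0)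
  have hK : 0 ≤ Kc T θ' N := Kc_nonneg T hθ'0.le N
  have hKle : Kc T θ' N ≤ C * θ' / (θ' - θ) := Kc_le_of_powerBound hP hθ hθ' N
  refine (cocycleBound_of_near_ref hθ'0 hN hTN hU).mono hKle (by positivity) ?_ (hK.trans hKle)
  exact add_le_add le_rfl (mul_le_mul_of_nonneg_right hKle hδ)

/-! ## §3 The bridge to node U2's `FadingMemory` -/

/-- HYPOTHESIS SHAPE (structural, NOT PRINTED) — THE HISTORY MODULI ARE DOMINATED BY THE TRANSFER COCYCLE:
`0 ≤ Λ k i ≤ D ‖prodStep U i (k − i)‖` for `i ≤ k` — the influence of the coupling `g_i` on `β_{k+1}` is read out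
(bounded read-out and injection, constant `D`) from the linearised transfer of the brackets from scale `i` to scale `k`
(chain rule through `E_{j+1} = A E_j + V^{(j+1)}[g_j; E_j]`, the structural consequence of [I] (2.13) recorded in
`T4BetaMemory`'s header; the index convention is immaterial up to one factor of the rate).  On the toy rung this is
R1(i) ("β by linear read-out t_β"). [folklore] -/
def TransferDominated (D : ℝ) (U : ℕ → A) (Λ : ℕ → ℕ → ℝ) : Prop :=
  ∀ k i, i ≤ k → 0 ≤ Λ k i ∧ Λ k i ≤ D * ‖prodStep U i (k - i)‖

/-- **BRIDGE.**  `CocycleBound C θ U` and `TransferDominated D U Λ` (`D ≥ 0`) give node U2's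
`T4CouplingMatching.FadingMemory (D C) θ Λ`.  Together with §2 this is the located sharp form of the memory input of
NE4: a power-contracting REFERENCE linearisation plus SMALLNESS OF THE NON-AUTONOMOUS PART (or contraction of every step
in one common norm) — not a per-step spectral radius bound (§4). [folklore] -/
theorem fadingMemory_of_cocycleBound {C θ D : ℝ} {U : ℕ → A} {Λ : ℕ → ℕ → ℝ} (hU : CocycleBound C θ U)
    (hD : 0 ≤ D) (hΛ : TransferDominated D U Λ) : FadingMemory (D * C) θ Λ := by
  intro k i hik
  refine ⟨(hΛ k i hik).1, (hΛ k i hik).2.trans ?_⟩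
  calc D * ‖prodStep U i (k - i)‖ ≤ D * (C * θ ^ (k - i)) := mul_le_mul_of_nonneg_left (hU i (k - i)) hD
    _ = D * C * θ ^ (k - i) := (mul_assoc _ _ _).symm

/-- **BRIDGE, rate-level form.**  Reference power bound `PowerBound C θ T` (`0 ≤ θ < θ′`), actual steps within `δ` of
it, moduli dominated by the transfer with constant `D ≥ 0` ⟹ `FadingMemory (D K) (θ′ + K δ) Λ`, `K = Cθ′/(θ′ − θ)`;
fading memory in the sense of node U2 (`rate < 1`) as soon as `θ′ + K δ < 1`, i.e. inside an explicit SMALLNESS WINDOW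
for the non-autonomous part — the kernel form of the toy rung's «window» (R3) and of `T4BetaMemory`'s `hsmall`, with
the honest constant. [folklore] -/
theorem fadingMemory_of_powerBound {T : A} {U : ℕ → A} {Λ : ℕ → ℕ → ℝ} {C θ θ' δ D : ℝ}
    (hP : PowerBound C θ T) (hθ : 0 ≤ θ) (hθ' : θ < θ') (hU : ∀ k, ‖U k - T‖ ≤ δ) (hD : 0 ≤ D)
    (hΛ : TransferDominated D U Λ) :
    FadingMemory (D * (C * θ' / (θ' - θ))) (θ' + C * θ' / (θ' - θ) * δ) Λ :=
  fadingMemory_of_cocycleBound (cocycleBound_of_powerBound hP hθ hθ' hU) hD hΛ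

end Normed

/-! ## §4 The hazard: per-step spectral radius zero, products growing like `2ⁿ` (kernel witness) -/

section Hazard

open Matrix

-- Mathlib's `L¹–L^∞` operator norm on square matrices (`Matrix.linftyOpNormedRing`, file
-- `Mathlib/Analysis/Matrix/Normed.lean`) is a `def`, not a global instance, because several matrix norms are natural;
-- it is enabled LOCALLY for this section only, as Mathlib intends.  It is submultiplicative and `‖diagonal v‖ = ‖v‖∞`.
attribute [local instance] Matrix.linftyOpNormedRing

/-- In any algebra over a normed field, `a ^ 2 = 0` forces spectral radius `0` (`ρ(a)² ≤ ρ(a²) = ρ(0) = 0`,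
Mathlib `spectrum.spectralRadius_pow_le`).  Norm-free. [folklore] -/
theorem spectralRadius_eq_zero_of_sq_eq_zero {𝕜 B : Type*} [NormedField 𝕜] [Ring B] [Algebra 𝕜 B] {a : B}
    (h : a ^ 2 = 0) : spectralRadius 𝕜 a = 0 := by
  have h2 := spectrum.spectralRadius_pow_le (𝕜 := 𝕜) a 2 two_ne_zero
  rw [h, spectrum.spectralRadius_zero] at h2
  exact (pow_eq_zero_iff two_ne_zero).mp (nonpos_iff_eq_zero.mp h2)

/-- First step of the witness: `T₀ = !![0, 2; 0, 0]`. [folklore] -/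
def T₀ : Matrix (Fin 2) (Fin 2) ℝ := !![0, 2; 0, 0]

/-- Second step of the witness: `T₁ = !![0, 0; 2, 0]`. [folklore] -/
def T₁ : Matrix (Fin 2) (Fin 2) ℝ := !![0, 0; 2, 0]

/-- The alternating step sequence `T₀, T₁, T₀, T₁, …`. [folklore] -/
def alt (k : ℕ) : Matrix (Fin 2) (Fin 2) ℝ := if Even k then T₀ else T₁

/-- `T₀` is nilpotent of order two. [folklore] -/
theorem T₀_sq : T₀ ^ 2 = 0 := by
  ext i j
  fin_cases i <;> fin_cases j <;> norm_num [T₀, pow_two, Matrix.mul_apply, Fin.sum_univ_two]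

/-- `T₁` is nilpotent of order two. [folklore] -/
theorem T₁_sq : T₁ ^ 2 = 0 := by
  ext i j
  fin_cases i <;> fin_cases j <;> norm_num [T₁, pow_two, Matrix.mul_apply, Fin.sum_univ_two]

/-- Each step has spectral radius ZERO. [folklore] -/
theorem spectralRadius_T₀ : spectralRadius ℝ T₀ = 0 := spectralRadius_eq_zero_of_sq_eq_zero T₀_sq

/-- Each step has spectral radius ZERO (second step). [folklore] -/
theorem spectralRadius_T₁ : spectralRadius ℝ T₁ = 0 := spectralRadius_eq_zero_of_sq_eq_zero T₁_sq

/-- … and each step ALONE is power-bounded at EVERY rate `θ′ > 0` (`powerBound_of_pow_le` with `N = 2`,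
`‖T₀ ^ 2‖ = 0`). [folklore] -/
theorem powerBound_T₀ {θ' : ℝ} (hθ : 0 < θ') : PowerBound (Kc T₀ θ' 2) θ' T₀ :=
  powerBound_of_pow_le hθ (by norm_num) (by rw [T₀_sq, norm_zero]; positivity)

/-- … likewise the second step. [folklore] -/
theorem powerBound_T₁ {θ' : ℝ} (hθ : 0 < θ') : PowerBound (Kc T₁ θ' 2) θ' T₁ :=
  powerBound_of_pow_le hθ (by norm_num) (by rw [T₁_sq, norm_zero]; positivity)

/-- Two consecutive steps of the alternating sequence multiply to `diagonal (0, 4)`. [folklore] -/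
theorem T₁_mul_T₀ : T₁ * T₀ = Matrix.diagonal ![0, 4] := by
  ext i j
  fin_cases i <;> fin_cases j <;> norm_num [T₀, T₁, Matrix.mul_apply, Fin.sum_univ_two, Matrix.diagonal]

/-- The alternating cocycle over an even number of steps is a power of `T₁ T₀`. [folklore] -/
theorem prodStep_alt (m : ℕ) : prodStep alt 0 (2 * m) = (T₁ * T₀) ^ m := by
  induction m with
  | zero => simp
  | succ m ih =>
    rw [show 2 * (m + 1) = (2 * m + 1) + 1 by ring, prodStep_succ, prodStep_succ, ih, pow_succ' (T₁ * T₀)]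
    simp [alt, mul_assoc]

/-- GROWTH: in the `L¹–L^∞` operator norm, `‖prodStep alt 0 (2m)‖ ≥ 4^m` — the products of the two spectral-radius-zero
steps grow like `2ⁿ` in the number `n = 2m` of steps. [folklore] -/
theorem hazard_growth (m : ℕ) : (4 : ℝ) ^ m ≤ ‖prodStep alt 0 (2 * m)‖ := by
  rw [prodStep_alt, T₁_mul_T₀, Matrix.diagonal_pow, Matrix.linfty_opNorm_diagonal]
  have h := norm_le_pi_norm (![(0 : ℝ), 4] ^ m) 1
  simpa using h

/-- **THE HAZARD.**  The alternating sequence admits NO cocycle bound `‖prodStep alt i n‖ ≤ C θ^n` with `0 ≤ θ < 2`,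
for any constant `C` — although every step has spectral radius `0` and is power-bounded at every positive rate
(`spectralRadius_T₀`, `powerBound_T₀`).  Hence «ρ(step_k) ≤ θ < 1 for all k» is NOT a sufficient form of node U2's memory
input when the linearisation depends on the scale; the cocycle bound (`CocycleBound`) is.  Cell GAPS G-t4-U2R2-5.
[folklore] -/
theorem hazard_not_cocycleBound (C θ : ℝ) (hθ0 : 0 ≤ θ) (hθ2 : θ < 2) : ¬ CocycleBound C θ alt := by
  intro h
  have key : ∀ m, (4 : ℝ) ^ m ≤ C * (θ ^ 2) ^ m := fun m => by
    have := (hazard_growth m).trans (h 0 (2 * m))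
    rwa [pow_mul] at this
  have hC : 1 ≤ C := by simpa using key 0
  have hCpos : 0 < C := by linarith
  have hx0 : 0 ≤ θ ^ 2 / 4 := by positivity
  have hx1 : θ ^ 2 / 4 < 1 := by
    rw [div_lt_one (by norm_num : (0 : ℝ) < 4)]
    nlinarith
  obtain ⟨m, hm⟩ := exists_pow_lt_of_lt_one (one_div_pos.mpr hCpos) hx1
  have h4 : (0 : ℝ) < 4 ^ m := by positivity
  have hlt : C * (θ ^ 2) ^ m < 4 ^ m := by
    calc C * (θ ^ 2) ^ m = C * (θ ^ 2 / 4) ^ m * 4 ^ m := by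
          rw [div_pow, mul_assoc, div_mul_cancel₀]
          exact pow_ne_zero _ (by norm_num)
      _ < C * (1 / C) * 4 ^ m := by gcongr
      _ = 4 ^ m := by field_simp
  exact absurd (key m) (not_le.mpr hlt)

end Hazard

/-! ## §5 (v1.1) Common flag ⟹ no hazard: non-autonomous variation inside ONE flag costs only the constant -/

section Flag

open Matrix

-- as in §4: Mathlib's non-global `L¹–L^∞` matrix operator norm, enabled for this section only.
attribute [local instance] Matrix.linftyOpNormedRing

/-- A step preserving the two-term flag `span(e₁) ⊂ ℝ²` read from the bottom: lower-triangular, with diagonal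
(«dimension-preserving») entries `a`, `c` and lowering entry `b`. [folklore] -/
def flagStep (a b c : ℝ) : Matrix (Fin 2) (Fin 2) ℝ := !![a, 0; b, c]

/-- A non-autonomous sequence of steps preserving ONE COMMON flag. [folklore] -/
def flagSeq (a b c : ℕ → ℝ) (k : ℕ) : Matrix (Fin 2) (Fin 2) ℝ := flagStep (a k) (b k) (c k)

/-- Row-sum bounds give an `L¹–L^∞` operator-norm bound (`Fin 2` case of `‖M‖ = max_i Σ_j |M i j|`). [folklore] -/
theorem linfty_opNorm_le_of_rows (M : Matrix (Fin 2) (Fin 2) ℝ) {r : ℝ}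
    (h0 : |M 0 0| + |M 0 1| ≤ r) (h1 : |M 1 0| + |M 1 1| ≤ r) : ‖M‖ ≤ r := by
  have hr : 0 ≤ r := le_trans (by positivity) h0
  rw [Matrix.linfty_opNorm_def]
  have key : ∀ i : Fin 2, (↑(∑ j : Fin 2, ‖M i j‖₊) : ℝ) ≤ r := by
    intro i
    push_cast
    fin_cases i
    · simpa [Fin.sum_univ_two, Real.norm_eq_abs] using h0
    · simpa [Fin.sum_univ_two, Real.norm_eq_abs] using h1
  have hsup : (Finset.univ.sup fun i : Fin 2 => ∑ j : Fin 2, ‖M i j‖₊) ≤ ⟨r, hr⟩ :=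
    Finset.sup_le fun i _ => by rw [← NNReal.coe_le_coe]; exact key i
  calc ((Finset.univ.sup fun i : Fin 2 => ∑ j : Fin 2, ‖M i j‖₊ : NNReal) : ℝ) ≤ ((⟨r, hr⟩ : NNReal) : ℝ) :=
      NNReal.coe_le_coe.mpr hsup
    _ = r := rfl

/-- ENTRIES OF THE FLAG COCYCLE.  Under `|a k|, |c k| ≤ θ` and `|b k| ≤ B` (no condition whatsoever on how `a, b, c`
VARY with `k`): the flag is preserved (`(0,1)` entry `0`), the diagonal entries of `prodStep (flagSeq a b c) i n` are
bounded by `θ^n`, and the lowering entry by the convolution bound `B/(θ′−θ)·(θ′^n − θ^n)` for every `θ′ > θ`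
(equivalently `n B θ^{n−1}`, written in the form that propagates by induction). [folklore] -/
theorem flag_entries {a b c : ℕ → ℝ} {θ θ' B : ℝ} (hθ : 0 ≤ θ) (hθ' : θ < θ') (hB : 0 ≤ B)
    (ha : ∀ k, |a k| ≤ θ) (hb : ∀ k, |b k| ≤ B) (hc : ∀ k, |c k| ≤ θ) (i n : ℕ) :
    prodStep (flagSeq a b c) i n 0 1 = 0 ∧
    |prodStep (flagSeq a b c) i n 0 0| ≤ θ ^ n ∧
    |prodStep (flagSeq a b c) i n 1 1| ≤ θ ^ n ∧
    |prodStep (flagSeq a b c) i n 1 0| ≤ B / (θ' - θ) * (θ' ^ n - θ ^ n) := by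
  have hD : 0 < θ' - θ := sub_pos.mpr hθ'
  induction n with
  | zero =>
    refine ⟨?_, ?_, ?_, ?_⟩ <;> simp [prodStep_zero]
  | succ n ih =>
    obtain ⟨h01, h00, h11, h10⟩ := ih
    rw [prodStep_succ]
    have e00 : (flagSeq a b c (i + n) * prodStep (flagSeq a b c) i n) 0 0
        = a (i + n) * prodStep (flagSeq a b c) i n 0 0 := by
      simp [flagSeq, flagStep, Matrix.mul_apply, Fin.sum_univ_two]
    have e01 : (flagSeq a b c (i + n) * prodStep (flagSeq a b c) i n) 0 1
        = a (i + n) * prodStep (flagSeq a b c) i n 0 1 := by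
      simp [flagSeq, flagStep, Matrix.mul_apply, Fin.sum_univ_two]
    have e10 : (flagSeq a b c (i + n) * prodStep (flagSeq a b c) i n) 1 0
        = b (i + n) * prodStep (flagSeq a b c) i n 0 0 + c (i + n) * prodStep (flagSeq a b c) i n 1 0 := by
      simp [flagSeq, flagStep, Matrix.mul_apply, Fin.sum_univ_two]
    have e11 : (flagSeq a b c (i + n) * prodStep (flagSeq a b c) i n) 1 1
        = b (i + n) * prodStep (flagSeq a b c) i n 0 1 + c (i + n) * prodStep (flagSeq a b c) i n 1 1 := by
      simp [flagSeq, flagStep, Matrix.mul_apply, Fin.sum_univ_two]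
    refine ⟨?_, ?_, ?_, ?_⟩
    · rw [e01, h01, mul_zero]
    · rw [e00, abs_mul, pow_succ']
      exact mul_le_mul (ha _) h00 (abs_nonneg _) hθ
    · rw [e11, h01, mul_zero, zero_add, abs_mul, pow_succ']
      exact mul_le_mul (hc _) h11 (abs_nonneg _) hθ
    · rw [e10]
      have h1 : θ ^ n ≤ θ' ^ n := pow_le_pow_left₀ hθ hθ'.le n
      have hKD : B / (θ' - θ) * (θ' - θ) = B := div_mul_cancel₀ B hD.ne'
      calc |b (i + n) * prodStep (flagSeq a b c) i n 0 0 + c (i + n) * prodStep (flagSeq a b c) i n 1 0|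
          ≤ |b (i + n)| * |prodStep (flagSeq a b c) i n 0 0| + |c (i + n)| * |prodStep (flagSeq a b c) i n 1 0| := by
            refine (abs_add_le _ _).trans ?_
            rw [abs_mul, abs_mul]
        _ ≤ B * θ ^ n + θ * (B / (θ' - θ) * (θ' ^ n - θ ^ n)) :=
            add_le_add (mul_le_mul (hb _) h00 (abs_nonneg _) hB) (mul_le_mul (hc _) h10 (abs_nonneg _) hθ)
        _ ≤ B / (θ' - θ) * (θ' ^ (n + 1) - θ ^ (n + 1)) := by
            rw [pow_succ, pow_succ]
            have key : B / (θ' - θ) * (θ' ^ n * θ' - θ ^ n * θ) - (B * θ ^ n + θ * (B / (θ' - θ) * (θ' ^ n - θ ^ n)))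
                = B * (θ' ^ n - θ ^ n) := by
              have e : B / (θ' - θ) * (θ' ^ n * θ' - θ ^ n * θ)
                  - (B * θ ^ n + θ * (B / (θ' - θ) * (θ' ^ n - θ ^ n)))
                  = B / (θ' - θ) * (θ' - θ) * θ' ^ n - B * θ ^ n := by ring
              rw [e, hKD]; ring
            have hnn : 0 ≤ B * (θ' ^ n - θ ^ n) := mul_nonneg hB (sub_nonneg.mpr h1)
            linarith

/-- **COMMON FLAG ⇒ NO HAZARD.**  If every step preserves ONE COMMON flag (lower-triangular in a fixed basis) with
diagonal rates `≤ θ` and lowering entries `≤ B`, then the transfer cocycle obeys `CocycleBound (1 + B/(θ′−θ)) θ′` for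
EVERY `θ′ > θ` — whatever the variation of the entries from step to step.  Arbitrary, arbitrarily fast non-autonomous
variation INSIDE a common flag costs only the constant, never the rate; contrast `hazard_not_cocycleBound`, where the
two nilpotent steps are triangular for OPPOSITE flags.  This is the kernel form of the toy rung's R1(ii) («history
insertions are degree-lowering at every step — nilpotent, no effect on any rate») made uniform over the history: the
Taylor-degree filtration is a flag common to all steps, the dimension-preserving diagonal carries the rate.  Two-term
flag = the minimal model; longer flags follow by induction on the length (not typed here). [folklore] -/
theorem flag_cocycleBound {a b c : ℕ → ℝ} {θ θ' B : ℝ} (hθ : 0 ≤ θ) (hθ' : θ < θ') (hB : 0 ≤ B)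
    (ha : ∀ k, |a k| ≤ θ) (hb : ∀ k, |b k| ≤ B) (hc : ∀ k, |c k| ≤ θ) :
    CocycleBound (1 + B / (θ' - θ)) θ' (flagSeq a b c) := by
  intro i n
  obtain ⟨h01, h00, h11, h10⟩ := flag_entries hθ hθ' hB ha hb hc i n
  have hD : 0 < θ' - θ := sub_pos.mpr hθ'
  have h1 : θ ^ n ≤ θ' ^ n := pow_le_pow_left₀ hθ hθ'.le n
  have hK : 0 ≤ B / (θ' - θ) := div_nonneg hB hD.le
  have hKp : 0 ≤ B / (θ' - θ) * θ' ^ n := mul_nonneg hK (pow_nonneg (hθ.trans hθ'.le) n)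
  have hKq : 0 ≤ B / (θ' - θ) * θ ^ n := mul_nonneg hK (pow_nonneg hθ n)
  apply linfty_opNorm_le_of_rows
  · rw [h01, abs_zero, add_zero]
    linarith [h00.trans h1]
  · linarith [add_le_add h10 h11]

/-- The diagonal steps alone show the rate `θ′ ↓ θ` cannot be improved, and the constant must blow up as `θ′ ↓ θ`:
with `a = c ≡ θ`, `b ≡ B` the lowering entry of the `n`-step product is exactly `n B θ^{n−1}` (here: the closed form
`B/(θ′−θ)·(θ′^n − θ^n)` is attained in the limit, and at `θ′ = θ` no constant works unless `B = 0`).  Recorded as the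
equality case of the recursion: [folklore] -/
theorem flag_entries_const (θ B : ℝ) (n : ℕ) :
    prodStep (flagSeq (fun _ => θ) (fun _ => B) (fun _ => θ)) 0 n 1 0 = n * B * θ ^ (n - 1) := by
  induction n with
  | zero => simp [prodStep_zero]
  | succ n ih =>
    have e10 : (flagSeq (fun _ => θ) (fun _ => B) (fun _ => θ) (0 + n)
          * prodStep (flagSeq (fun _ => θ) (fun _ => B) (fun _ => θ)) 0 n) 1 0
        = B * prodStep (flagSeq (fun _ => θ) (fun _ => B) (fun _ => θ)) 0 n 0 0
          + θ * prodStep (flagSeq (fun _ => θ) (fun _ => B) (fun _ => θ)) 0 n 1 0 := by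
      simp [flagSeq, flagStep, Matrix.mul_apply, Fin.sum_univ_two]
    have e00 : ∀ m, prodStep (flagSeq (fun _ => θ) (fun _ => B) (fun _ => θ)) 0 m 0 0 = θ ^ m := by
      intro m
      induction m with
      | zero => simp [prodStep_zero]
      | succ m ihm =>
        rw [prodStep_succ]
        have : (flagSeq (fun _ => θ) (fun _ => B) (fun _ => θ) (0 + m)
            * prodStep (flagSeq (fun _ => θ) (fun _ => B) (fun _ => θ)) 0 m) 0 0
            = θ * prodStep (flagSeq (fun _ => θ) (fun _ => B) (fun _ => θ)) 0 m 0 0 := by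
          simp [flagSeq, flagStep, Matrix.mul_apply, Fin.sum_univ_two]
        rw [this, ihm, pow_succ']
    rw [prodStep_succ, e10, e00, ih]
    rcases n with _ | n
    · simp
    · push_cast
      simp only [pow_succ]
      ring

/-- Bridge for flag-preserving transfers: moduli dominated by the flag cocycle fade at every rate `θ′ > θ` with the
constant `D (1 + B/(θ′−θ))` — `T4CouplingMatching.FadingMemory` fed WITHOUT any smallness or slow-variation condition
on the lowering (history-insertion) entries. [folklore] -/
theorem fadingMemory_of_flag {a b c : ℕ → ℝ} {θ θ' B D : ℝ} {Λ : ℕ → ℕ → ℝ} (hθ : 0 ≤ θ) (hθ' : θ < θ')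
    (hB : 0 ≤ B) (ha : ∀ k, |a k| ≤ θ) (hb : ∀ k, |b k| ≤ B) (hc : ∀ k, |c k| ≤ θ) (hD : 0 ≤ D)
    (hΛ : TransferDominated D (flagSeq a b c) Λ) : FadingMemory (D * (1 + B / (θ' - θ))) θ' Λ :=
  fadingMemory_of_cocycleBound (flag_cocycleBound hθ hθ' hB ha hb hc) hD hΛ

end Flag

/-! ## §6 (v1.1) Sufficient condition 3: slow variation (frozen-step Lyapunov gauges) -/

section SlowVariation

variable {A : Type*} [NormedRing A]

/-- GAUGE DRIFT between two references `U` (old) and `V` (new) at rate `θ′` and depth `N`: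
`Σ_{n<N} θ′^{−n} ‖V^n − U^n‖` — how much the adapted gauge of §2 changes when the reference is replaced. [folklore] -/
noncomputable def drift (U V : A) (θ' : ℝ) (N : ℕ) : ℝ := ∑ n ∈ range N, θ'⁻¹ ^ n * ‖V ^ n - U ^ n‖

/-- The drift is non-negative. [folklore] -/
theorem drift_nonneg (U V : A) {θ' : ℝ} (hθ : 0 ≤ θ') (N : ℕ) : 0 ≤ drift U V θ' N :=
  sum_nonneg fun _ _ => mul_nonneg (pow_nonneg (inv_nonneg.mpr hθ) _) (norm_nonneg _)

/-- Changing the reference costs at most the drift: `gauge_V(S) ≤ gauge_U(S) + drift(U,V)·‖S‖`. [folklore] -/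
theorem gauge_le_gauge_add_drift (U V : A) {θ' : ℝ} (hθ : 0 ≤ θ') (N : ℕ) (S : A) :
    gauge V θ' N S ≤ gauge U θ' N S + drift U V θ' N * ‖S‖ := by
  unfold gauge drift
  rw [sum_mul, ← sum_add_distrib]
  refine sum_le_sum fun n _ => ?_
  have hw : 0 ≤ θ'⁻¹ ^ n := pow_nonneg (inv_nonneg.mpr hθ) n
  have e : V ^ n * S = U ^ n * S + (V ^ n - U ^ n) * S := by rw [sub_mul]; abel
  calc θ'⁻¹ ^ n * ‖V ^ n * S‖ = θ'⁻¹ ^ n * ‖U ^ n * S + (V ^ n - U ^ n) * S‖ := by rw [← e]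
    _ ≤ θ'⁻¹ ^ n * (‖U ^ n * S‖ + ‖V ^ n - U ^ n‖ * ‖S‖) :=
        mul_le_mul_of_nonneg_left ((norm_add_le _ _).trans (add_le_add le_rfl (norm_mul_le _ _))) hw
    _ = θ'⁻¹ ^ n * ‖U ^ n * S‖ + θ'⁻¹ ^ n * ‖V ^ n - U ^ n‖ * ‖S‖ := by ring

/-- Telescoping: `‖V^{n+1} − U^{n+1}‖ ≤ (n+1) M^n ‖V − U‖`-type bound for `‖U‖, ‖V‖ ≤ M`. [folklore] -/
theorem norm_pow_sub_pow_le {U V : A} {M ε : ℝ} (hM : 0 ≤ M) (hU : ‖U‖ ≤ M) (hV : ‖V‖ ≤ M) (h : ‖V - U‖ ≤ ε) :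
    ∀ n : ℕ, ‖V ^ (n + 1) - U ^ (n + 1)‖ ≤ (n + 1) * M ^ n * ε
  | 0 => by simpa using h
  | n + 1 => by
    have ih := norm_pow_sub_pow_le hM hU hV h n
    have hε : 0 ≤ ε := (norm_nonneg _).trans h
    have e : V * V ^ (n + 1) - U * U ^ (n + 1) = V * (V ^ (n + 1) - U ^ (n + 1)) + (V - U) * U ^ (n + 1) := by
      rw [mul_sub, sub_mul]; abel
    have hUp : ‖U ^ (n + 1)‖ ≤ M ^ (n + 1) :=
      (norm_pow_le' U n.succ_pos).trans (pow_le_pow_left₀ (norm_nonneg _) hU _)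
    rw [pow_succ' V (n + 1), pow_succ' U (n + 1), e]
    calc ‖V * (V ^ (n + 1) - U ^ (n + 1)) + (V - U) * U ^ (n + 1)‖
        ≤ ‖V‖ * ‖V ^ (n + 1) - U ^ (n + 1)‖ + ‖V - U‖ * ‖U ^ (n + 1)‖ :=
          (norm_add_le _ _).trans (add_le_add (norm_mul_le _ _) (norm_mul_le _ _))
      _ ≤ M * ((n + 1) * M ^ n * ε) + ε * M ^ (n + 1) :=
          add_le_add (mul_le_mul hV ih (norm_nonneg _) hM) (mul_le_mul h hUp (norm_nonneg _) hε)
      _ = ((↑(n + 1) : ℝ) + 1) * M ^ (n + 1) * ε := by push_cast; ring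

/-- The drift constant `Ec M θ′ N = Σ_{n<N} θ′^{−n} · n M^{n−1}` (explicit, finite). [folklore] -/
noncomputable def Ec (M θ' : ℝ) (N : ℕ) : ℝ := ∑ n ∈ range N, θ'⁻¹ ^ n * (n * M ^ (n - 1))

/-- Drift is Lipschitz in the reference: `‖U‖, ‖V‖ ≤ M`, `‖V − U‖ ≤ ε` ⟹ `drift U V θ′ N ≤ Ec M θ′ N · ε`. [folklore] -/
theorem drift_le {U V : A} {M ε θ' : ℝ} (hθ : 0 ≤ θ') (hM : 0 ≤ M) (hU : ‖U‖ ≤ M) (hV : ‖V‖ ≤ M)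
    (h : ‖V - U‖ ≤ ε) (N : ℕ) : drift U V θ' N ≤ Ec M θ' N * ε := by
  unfold drift Ec
  rw [sum_mul]
  refine sum_le_sum fun n _ => ?_
  have hw : 0 ≤ θ'⁻¹ ^ n := pow_nonneg (inv_nonneg.mpr hθ) n
  rw [mul_assoc]
  refine mul_le_mul_of_nonneg_left ?_ hw
  rcases n with _ | m
  · simp
  · have := norm_pow_sub_pow_le hM hU hV h m
    simpa using this

/-- **SUFFICIENT CONDITION 3 — SLOW VARIATION (frozen-step form).**  If every step `U k` is power-contracting at a COMMON
depth, `‖(U k)^N‖ ≤ θ′^N`, with adapted constants `Kc (U k) θ′ N ≤ K`, and consecutive steps are close in the sense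
of the gauge drift, `drift (U k) (U (k+1)) θ′ N ≤ η`, then the transfer cocycle obeys
`CocycleBound K (θ′ (1 + η)) U`.  Proof: the adapted gauge of the CURRENT step is a time-dependent Lyapunov norm —
the step contracts it by `θ′` (`gauge_ref_mul`), passing to the next step's gauge costs the factor `1 + η`
(`gauge_le_gauge_add_drift`, `norm_le_gauge`).  This is the clause missing from the wording «ρ(step_k) ≤ θ < 1 ∀k»:
per-step contraction in the uniform, norm-visible form `‖(U k)^N‖ ≤ θ′^N, Kc ≤ K` PLUS slow variation `η`; the
hazard sequence `alt` of §4 has `η = 2/θ′` at depth 2, whence the bound `θ′ + 2 ≥ 2` — consistent with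
`hazard_not_cocycleBound`.  Discrete analogue of the Coppel / Henry «slowly varying coefficients» theorems
(orientation: Henry LNM 840 §7.6; Anagnostopoulou–Pötzsche–Rasmussen 2023 App. A); kernel-proved here. [folklore] -/
theorem cocycleBound_of_slowVariation {U : ℕ → A} {θ' K η : ℝ} {N : ℕ} (hθ : 0 < θ') (hN : 1 ≤ N)
    (hpow : ∀ k, ‖U k ^ N‖ ≤ θ' ^ N) (hK : ∀ k, Kc (U k) θ' N ≤ K) (hη : 0 ≤ η)
    (hdrift : ∀ k, drift (U k) (U (k + 1)) θ' N ≤ η) :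
    CocycleBound K (θ' * (1 + η)) U := by
  intro i n
  have chain : ∀ n, gauge (U (i + n)) θ' N (prodStep U i n) ≤ K * (θ' * (1 + η)) ^ n := by
    intro n
    induction n with
    | zero => simpa [gauge_one] using hK i
    | succ n ih =>
      rw [show i + (n + 1) = i + n + 1 from rfl, prodStep_succ, pow_succ]
      calc gauge (U (i + n + 1)) θ' N (U (i + n) * prodStep U i n)
          ≤ gauge (U (i + n)) θ' N (U (i + n) * prodStep U i n)
            + drift (U (i + n)) (U (i + n + 1)) θ' N * ‖U (i + n) * prodStep U i n‖ :=
              gauge_le_gauge_add_drift (U (i + n)) (U (i + n + 1)) hθ.le N _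
        _ ≤ gauge (U (i + n)) θ' N (U (i + n) * prodStep U i n)
            + η * gauge (U (i + n)) θ' N (U (i + n) * prodStep U i n) :=
              add_le_add le_rfl
                (mul_le_mul (hdrift _) (norm_le_gauge (U (i + n)) hθ.le hN _) (norm_nonneg _) hη)
        _ = (1 + η) * gauge (U (i + n)) θ' N (U (i + n) * prodStep U i n) := by ring
        _ ≤ (1 + η) * (θ' * gauge (U (i + n)) θ' N (prodStep U i n)) :=
              mul_le_mul_of_nonneg_left (gauge_ref_mul hθ hN (hpow _) _) (by linarith)
        _ ≤ (1 + η) * (θ' * (K * (θ' * (1 + η)) ^ n)) :=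
              mul_le_mul_of_nonneg_left (mul_le_mul_of_nonneg_left ih hθ.le) (by linarith)
        _ = K * ((θ' * (1 + η)) ^ n * (θ' * (1 + η))) := by ring
  exact (norm_le_gauge (U (i + n)) hθ.le hN _).trans (chain n)

/-- Slow variation in the plain norm: `‖U k‖ ≤ M`, `‖U (k+1) − U k‖ ≤ ε` ⟹ rate `θ′ (1 + Ec M θ′ N · ε)`. [folklore] -/
theorem cocycleBound_of_slowVariation' {U : ℕ → A} {θ' K M ε : ℝ} {N : ℕ} (hθ : 0 < θ') (hN : 1 ≤ N)
    (hpow : ∀ k, ‖U k ^ N‖ ≤ θ' ^ N) (hK : ∀ k, Kc (U k) θ' N ≤ K) (hM : 0 ≤ M) (hUM : ∀ k, ‖U k‖ ≤ M)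
    (hε : 0 ≤ ε) (hvar : ∀ k, ‖U (k + 1) - U k‖ ≤ ε) :
    CocycleBound K (θ' * (1 + Ec M θ' N * ε)) U := by
  have hE : 0 ≤ Ec M θ' N := sum_nonneg fun n _ =>
    mul_nonneg (pow_nonneg (inv_nonneg.mpr hθ.le) _) (mul_nonneg (Nat.cast_nonneg n) (pow_nonneg hM _))
  exact cocycleBound_of_slowVariation hθ hN hpow hK (mul_nonneg hE hε)
    fun k => drift_le hθ.le hM (hUM k) (hUM (k + 1)) (hvar k) N

/-- Bridge: slow variation ⟹ `FadingMemory (D K) (θ′ (1 + η))` for transfer-dominated moduli. [folklore] -/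
theorem fadingMemory_of_slowVariation {U : ℕ → A} {Λ : ℕ → ℕ → ℝ} {θ' K η D : ℝ} {N : ℕ} (hθ : 0 < θ')
    (hN : 1 ≤ N) (hpow : ∀ k, ‖U k ^ N‖ ≤ θ' ^ N) (hK : ∀ k, Kc (U k) θ' N ≤ K) (hη : 0 ≤ η)
    (hdrift : ∀ k, drift (U k) (U (k + 1)) θ' N ≤ η) (hD : 0 ≤ D) (hΛ : TransferDominated D U Λ) :
    FadingMemory (D * K) (θ' * (1 + η)) Λ :=
  fadingMemory_of_cocycleBound (cocycleBound_of_slowVariation hθ hN hpow hK hη hdrift) hD hΛ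

end SlowVariation

end Literature.MathematicalPhysics.QuantumFieldTheory.Balaban1983to89.T4SpectralRenewal
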